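import Literature.Topology.FourManifolds.RegularLevelSplitting
import Literature.Topology.FourManifolds.RegularDomainMaps

/-!
# Stub `stub_sublevelTransfer` of line `lp-by-sphere-system-surgery` for crux `AgkCor6Sufficiency`
(item stmt-SmoothPoincare4-10894, routes CongruenceShadows / GroupTrisection; lead reshape r5)

**Sublevel transfer.**  Let `X`, `X'` be smooth `4`-manifolds without boundary, `{f ≤ a} ⊆ X` and
`{f' ≤ a'} ⊆ X'` regular sublevel sets (`IsRegularLevel`), and `G₀ : U₀ ≅ U₀'` a partial
diffeomorphism between open sets (`G₀`, `G₀inv` mutually inverse on `U₀`, `U₀'`, both `C^∞` there)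
with `{f ≤ a} ⊆ U₀` and `G₀ '' {f ≤ a} = {f' ≤ a'}`.  Then the `RegularSublevel` manifolds with
boundary `{f ≤ a}` and `{f' ≤ a'}` (Milnor's `Mᵃ`, half-slice atlases, model `𝓡∂ 4`) are
diffeomorphic.  Proof: the forward map is the codomain restriction of `G₀ ∘ incl`, which is `C^∞`
from `{f ≤ a}` to `X'` because the inclusion is smooth (`RegularSublevel.contMDiff_incl`) with
values in the open set `U₀` on which `G₀` is `C^∞`; a smooth map with values in a regular domain
is smooth into the domain (`HalfSliceAtlas.contMDiff_codRestrict`, Lee, *Introduction to Smooth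
Manifolds* (2013), Cor. 5.30).  Symmetrically for `G₀inv ∘ incl` (note `{f' ≤ a'} ⊆ U₀'` by the
image identity and `MapsTo G₀ U₀ U₀'`), and the two composites are identities by the inverse
identities on `U₀`, `U₀'`.  This is `RegularSublevel.diffeomorphOfPreimageEq` (the case `G₀ = id`)
transported along a partial diffeomorphism.  This file declares the line's statement
`SublevelTransfer` (verbatim from the checked skeleton) and proves the registered stub
`stub_sublevelTransfer`.  References: Milnor, *Morse theory* (1963), Thm. 3.1 [Milnor1963];
Lee (2013), Cor. 5.30 [LeeSmoothManifolds2013].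
-/

noncomputable section

-- the prescribed namespace `Summit.<P>.<Sub>.…` duplicates `SmoothPoincare4` (P = Sub)
set_option linter.dupNamespace false

open Set Function ContinuousMap
open scoped Manifold ContDiff Topology

namespace Summit.SmoothPoincare4.SmoothPoincare4.Cruxes.AgkCor6Sufficiency.LpBySphereSystemSurgery

open Literature.Topology.FourManifolds

/-! ## The statement (verbatim from the skeleton) -/

/-- **Sublevel transfer** (r5): a partial diffeomorphism `G₀ : U₀ ≅ U₀'` defined around a regular
sublevel set `{f ≤ a} ⊆ U₀` and carrying it onto a regular sublevel set `{f' ≤ a'}` induces a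
diffeomorphism of the `RegularSublevel` manifolds with boundary (smoothness into a regular domain
is tested in the ambient manifold, `HalfSliceAtlas.contMDiff_codRestrict`). -/
def SublevelTransfer : Prop :=
  ∀ (X : Type) [TopologicalSpace X] [T2Space X] [SecondCountableTopology X]
    [ChartedSpace (EuclideanSpace ℝ (Fin 4)) X] [IsManifold (𝓡 4) ∞ X]
    (X' : Type) [TopologicalSpace X'] [T2Space X'] [SecondCountableTopology X']
    [ChartedSpace (EuclideanSpace ℝ (Fin 4)) X'] [IsManifold (𝓡 4) ∞ X']
    (f : X → ℝ) (f' : X' → ℝ) (a a' : ℝ) (hf : IsRegularLevel (𝓡 4) f a)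
    (hf' : IsRegularLevel (𝓡 4) f' a')
    (U₀ : Set X) (U₀' : Set X') (G₀ : X → X') (G₀inv : X' → X), IsOpen U₀ → IsOpen U₀' →
    MapsTo G₀ U₀ U₀' → MapsTo G₀inv U₀' U₀ → (∀ x ∈ U₀, G₀inv (G₀ x) = x) →
    (∀ y ∈ U₀', G₀ (G₀inv y) = y) →
    ContMDiffOn (𝓡 4) (𝓡 4) ∞ G₀ U₀ → ContMDiffOn (𝓡 4) (𝓡 4) ∞ G₀inv U₀' →
    f ⁻¹' Set.Iic a ⊆ U₀ → G₀ '' (f ⁻¹' Set.Iic a) = f' ⁻¹' Set.Iic a' →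
    Nonempty (RegularSublevel hf ≃ₘ⟮𝓡∂ 4, 𝓡∂ 4⟯ RegularSublevel hf')

/-! ## Helpers -/

namespace SublevelTransfer

variable {X : Type} [TopologicalSpace X] [ChartedSpace (EuclideanSpace ℝ (Fin 4)) X]
  [IsManifold (𝓡 4) ∞ X]
  {X' : Type} [TopologicalSpace X'] [ChartedSpace (EuclideanSpace ℝ (Fin 4)) X']
  [IsManifold (𝓡 4) ∞ X']
  {f : X → ℝ} {a : ℝ}

omit [IsManifold (𝓡 4) ∞ X'] in
/-- **A map which is smooth on an open neighbourhood of a regular sublevel set is smooth on the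
sublevel manifold**: if `G` is `C^∞` on an open `U ⊇ {f ≤ a}`, then `G ∘ incl : {f ≤ a} → X'` is
`C^∞` for Milnor's manifold-with-boundary structure on `{f ≤ a}` (the inclusion is smooth,
`RegularSublevel.contMDiff_incl`). -/
theorem contMDiff_comp_incl (hf : IsRegularLevel (𝓡 4) f a) {U : Set X} {G : X → X'}
    (hU : IsOpen U) (hG : ContMDiffOn (𝓡 4) (𝓡 4) ∞ G U) (hsub : f ⁻¹' Set.Iic a ⊆ U) :
    ContMDiff (𝓡∂ 4) (𝓡 4) ∞ (G ∘ RegularSublevel.incl hf) := fun p =>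
  (hG.contMDiffAt (hU.mem_nhds (hsub p.2))).comp p (RegularSublevel.contMDiff_incl hf p)

/-- **Transfer of a regular sublevel manifold along a map smooth near it**: if `G` is `C^∞` on an
open `U ⊇ {f ≤ a}` and maps `{f ≤ a}` into a regular sublevel set `{f' ≤ a'} ⊆ X'`, then the
induced map `{f ≤ a} → {f' ≤ a'}` of `RegularSublevel` manifolds with boundary is `C^∞`
(smoothness into a regular domain is tested in the ambient manifold,
`HalfSliceAtlas.contMDiff_codRestrict`; Lee (2013), Cor. 5.30). -/
theorem contMDiff_codRestrict_comp_incl (hf : IsRegularLevel (𝓡 4) f a) {f' : X' → ℝ} {a' : ℝ}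
    (hf' : IsRegularLevel (𝓡 4) f' a') {U : Set X} {G : X → X'} (hU : IsOpen U)
    (hG : ContMDiffOn (𝓡 4) (𝓡 4) ∞ G U) (hsub : f ⁻¹' Set.Iic a ⊆ U)
    (hmem : ∀ p : RegularSublevel hf, (G ∘ RegularSublevel.incl hf) p ∈ f' ⁻¹' Set.Iic a') :
    ContMDiff (M' := RegularSublevel hf') (𝓡∂ 4) (𝓡∂ 4) ∞
      (Set.codRestrict (G ∘ RegularSublevel.incl hf) (f' ⁻¹' Set.Iic a') hmem) :=
  (RegularSublevel.halfSliceAtlas hf').contMDiff_codRestrict hmem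
    (contMDiff_comp_incl hf hU hG hsub)

end SublevelTransfer

/-! ## The registered stub -/

/-- **Registered stub `stub_sublevelTransfer`**: a partial diffeomorphism around two regular
sublevel sets carrying one onto the other induces a diffeomorphism of the `RegularSublevel`
manifolds with boundary (see the file docstring for the proof). -/
theorem stub_sublevelTransfer : SublevelTransfer := by
  intro X _ _ _ _ _ X' _ _ _ _ _ f f' a a' hf hf' U₀ U₀' G₀ G₀inv hU₀ hU₀' hG₀ _ hleft hright
    hG₀s hG₀invs hsub himg
  -- `G₀` carries `{f ≤ a}` into `{f' ≤ a'}`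
  have hmem : ∀ p : RegularSublevel hf,
      (G₀ ∘ RegularSublevel.incl hf) p ∈ f' ⁻¹' Set.Iic a' := fun p =>
    himg ▸ mem_image_of_mem G₀ p.2
  -- `{f' ≤ a'} ⊆ U₀'`
  have hsub' : f' ⁻¹' Set.Iic a' ⊆ U₀' := by
    rw [← himg]
    rintro _ ⟨x, hx, rfl⟩
    exact hG₀ (hsub hx)
  -- `G₀inv` carries `{f' ≤ a'}` into `{f ≤ a}`
  have hmem' : ∀ q : RegularSublevel hf',
      (G₀inv ∘ RegularSublevel.incl hf') q ∈ f ⁻¹' Set.Iic a := by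
    intro q
    have hq : RegularSublevel.incl hf' q ∈ G₀ '' (f ⁻¹' Set.Iic a) := himg.symm ▸ q.2
    obtain ⟨x, hx, hxq⟩ := hq
    rw [comp_apply, ← hxq, hleft x (hsub hx)]
    exact hx
  exact
    ⟨{ toFun := Set.codRestrict (G₀ ∘ RegularSublevel.incl hf) (f' ⁻¹' Set.Iic a') hmem
       invFun := Set.codRestrict (G₀inv ∘ RegularSublevel.incl hf') (f ⁻¹' Set.Iic a) hmem'
       left_inv := fun p =>
         RegularSublevel.injective_incl hf (hleft (RegularSublevel.incl hf p) (hsub p.2))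
       right_inv := fun q =>
         RegularSublevel.injective_incl hf' (hright (RegularSublevel.incl hf' q) (hsub' q.2))
       contMDiff_toFun :=
         SublevelTransfer.contMDiff_codRestrict_comp_incl hf hf' hU₀ hG₀s hsub hmem
       contMDiff_invFun :=
         SublevelTransfer.contMDiff_codRestrict_comp_incl hf' hf hU₀' hG₀invs hsub' hmem' }⟩

end Summit.SmoothPoincare4.SmoothPoincare4.Cruxes.AgkCor6Sufficiency.LpBySphereSystemSurgery

end
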